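import Mathlib
import Summits.Ventures.PercRepro2.Defs
import Summits.Ventures.PercRepro2.Independence
import Summits.Ventures.PercRepro2.Harris
import Summits.Ventures.PercRepro2.Graph
import Summits.Ventures.PercRepro2.Events
import Summits.Ventures.PercRepro2.Induced
import Summits.Ventures.PercRepro2.BasePendant
import Summits.Ventures.PercRepro2.BHKAvoid
import Summits.Ventures.PercRepro2.ZCPendantFirstOrder
import Summits.Ventures.PercRepro2.ZCPendantSecondOrder
import Summits.Ventures.PercRepro2.ZCPendantTransfer
import Summits.Ventures.PercRepro2.ZCMain
import Summits.Ventures.PercRepro2.CDQuasiConcave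

/-!
# Row 2′CD when the second root is a leaf at `o` — a theorem through (ZC)
(blind cell PercRepro2, mine-a g31; MINE-A.md §86.13)

Roots `a₁, a₂`, marks `a₃, o`; row 2′CD in cleared form is `0 ≤ cdCleared p` (`CDQuasiConcave.lean`).
Let `a₂` be a LEAF whose only edge `f` goes to `o` (weight `t = p f`).  Then `C₂ = {a₂}` when `f` is
closed and `C₂ = {a₂} ∪ C'(o)` when `f` is open, `C'` the cluster in `G' = G − a₂` (weights
`p' = p[f↦0]`).  With the `G'`-events `e = {a₃ ∈ C'₁}`, `L = {o ∈ C'₁}`, `γ' = {a₃ ↔ o}`,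
`U = {C'₁ ∈ 𝓔}`, the types `χ = P'(eᶜL)`, `η_c = P'(eᶜLᶜγ')`, `η_d = P'(eᶜLᶜγ'ᶜ)`,
`X = Cov'(U, eLᶜ)`, `Y = Cov'(U, eL)`, `X′ = P'(L)P'(UeLᶜ) − P'(UL)P'(eLᶜ)`,
`Y′ = P'(L)P'(UeL) − P'(UL)P'(eL)`, the EXACT identity is `cdCleared p = (1 − t)·q(t)` with
`q(t) = [(1−t)χ − tη_c]·(X − tX′) + [(1−t)χ + tη_d]·(Y − tY′)`, a quadratic in `t` with nonnegative
Bernstein coefficients: `B₀ = χ·Cov'(U, e)` (Harris); `B₂ = P'(Lᶜ)·(ZC) + (P'(UL) − P'(U)P'(L))·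
(η_d P'(eL) − η_c P'(eLᶜ))` with `(ZC) ≥ 0` the theorem `zc_main` on `G'`, `P'(UL) ≥ P'(U)P'(L)`
(Harris) and `η_d P'(eL) ≥ η_c P'(eLᶜ)` the auxiliary odds inequality
`P'(a₃ ↔ o ∣ a₃ ∈ C'₁) ≥ P'(a₃ ↔ o ∣ a₃, o ∉ C'₁)` (two Harris inequalities, `aux_odds`);
`2B₁ = χ·[P'(Lᶜ)P'(Ue) − P'(ULᶜ)P'(e)] + (ZC) ≥ 0`.  Hence **row 2′CD holds whenever `a₂` is a leaf
at `o`** (`cd_of_leaf_a₂`) — the base of the exploration reduction of MINE-A.md §86.13.  One seat.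
-/

namespace Summit.Ventures.PercRepro2

namespace CDLeaf

section Transfer

variable {V : Type*} {E : Type*} [DecidableEq E] {ends : E → Sym2 V} {a₁ a₂ a₃ o : V} {f : E}

/-- With the leaf edge closed, the leaf `a₂` is connected to nothing else. -/
lemma not_conn_leaf_closed (hf : ends f = s(a₂, o)) (hleaf : ∀ e, a₂ ∈ ends e → e = f)
    (h2o : a₂ ≠ o) (ω : Config E) {v : V} (hv : v ≠ a₂) :
    ¬ Conn ends (Function.update ω f false) a₂ v := fun h =>
  hv (conn_leaf_closed hf hleaf h2o (Function.update_self f false ω) h)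

/-- Connections away from the leaf do not see the pin. -/
lemma conn_pin_iff (hf : ends f = s(a₂, o)) (hleaf : ∀ e, a₂ ∈ ends e → e = f) (h2o : a₂ ≠ o)
    (c : Bool) (ω : Config E) {x v : V} (hx : x ≠ a₂) (hv : v ≠ a₂) :
    Conn ends (Function.update ω f c) x v ↔ Conn ends ω x v :=
  conn_update_leaf_iff hf hleaf h2o c hx hv

/-- With the leaf edge open, `a₂ ↔ v` is `o ↔ v` in the closed world (`v ≠ a₂`). -/
lemma conn_leaf_open_iff (hf : ends f = s(a₂, o)) (hleaf : ∀ e, a₂ ∈ ends e → e = f)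
    (h2o : a₂ ≠ o) (ω : Config E) {v : V} (hv : v ≠ a₂) :
    Conn ends (Function.update ω f true) a₂ v ↔ Conn ends (Function.update ω f false) o v := by
  rw [conn_leaf_open hf (Function.update_self f true ω), conn_pin_iff hf hleaf h2o true ω h2o.symm hv,
    conn_pin_iff hf hleaf h2o false ω h2o.symm hv]

/-- With the leaf edge open, the cluster of `a₁` equals its closed-world cluster as soon as `o` is not
in the latter. -/
lemma cluster_open_eq_of_not_conn (hf : ends f = s(a₂, o)) (hleaf : ∀ e, a₂ ∈ ends e → e = f)
    (h2o : a₂ ≠ o) (h12 : a₁ ≠ a₂) (ω : Config E)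
    (hL : ¬ Conn ends (Function.update ω f false) a₁ o) :
    cluster ends (Function.update ω f true) a₁ = cluster ends (Function.update ω f false) a₁ := by
  ext v
  simp only [mem_cluster]
  by_cases hv : v = a₂
  · subst hv
    constructor
    · intro h
      exfalso
      apply hL
      have h' := conn_symm h
      rw [conn_leaf_open_iff hf hleaf h2o ω h12] at h'
      exact conn_symm h'
    · intro h
      exact absurd (conn_symm h) (not_conn_leaf_closed hf hleaf h2o ω h12)
  · rw [conn_pin_iff hf hleaf h2o true ω h12 hv, conn_pin_iff hf hleaf h2o false ω h12 hv]

end Transfer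

section Prob

variable {V : Type*} {E : Type*} [Fintype E] [DecidableEq E] {R : Type*} [Field R]

/-- Probabilities in the closed world depend only on the membership of the closed-forced
configurations. -/
lemma prob_update_zero_congr (p : E → R) (f : E) {A A' : Set (Config E)}
    (h : ∀ ω, Function.update ω f false ∈ A ↔ Function.update ω f false ∈ A') :
    prob (Function.update p f 0) A = prob (Function.update p f 0) A' := by
  rw [prob_eq_expect_indicator, prob_eq_expect_indicator, expect_update_zero, expect_update_zero]
  refine congrArg (expect p) (funext fun ω => ?_)
  by_cases hA : Function.update ω f false ∈ A
  · rw [Set.indicator_of_mem hA, Set.indicator_of_mem ((h ω).mp hA)]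
  · rw [Set.indicator_of_notMem hA, Set.indicator_of_notMem (fun hA' => hA ((h ω).mpr hA'))]

end Prob

section Main

variable {V : Type*} {E : Type*} [Fintype E] [DecidableEq E] [Fintype V] [DecidableEq V]
  {R : Type*} [Field R] [LinearOrder R] [IsStrictOrderedRing R]

omit [Fintype V] [DecidableEq V] in
/-- **The auxiliary odds inequality**: `P(γ' ∩ e) · P(eᶜ ∩ Lᶜ) ≥ P(γ' ∩ eᶜ ∩ Lᶜ) · P(e)` for
`e = {a₁ ↔ a₃}`, `L = {a₁ ↔ o}`, `γ' = {a₃ ↔ o}` — two Harris inequalities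
(`P(γ' ∣ a₃ ∈ C₁) ≥ P(γ') ≥ P(γ' ∣ a₃, o ∉ C₁)`). -/
lemma aux_odds (p : E → R) (hp : IsProbVec p) (ends : E → Sym2 V) (a₁ a₃ o : V) :
    prob p (connEvent ends a₃ o ∩ connEvent ends a₁ a₃) *
        prob p ((connEvent ends a₁ a₃)ᶜ ∩ (connEvent ends a₁ o)ᶜ) ≥
      prob p (connEvent ends a₃ o ∩ ((connEvent ends a₁ a₃)ᶜ ∩ (connEvent ends a₁ o)ᶜ)) *
        prob p (connEvent ends a₁ a₃) := by
  have h1 := prob_mul_prob_le_prob_inter hp (isUpperSet_connEvent ends a₃ o)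
    (isUpperSet_connEvent ends a₁ a₃)
  have hlow : IsLowerSet ((connEvent ends a₁ a₃)ᶜ ∩ (connEvent ends a₁ o)ᶜ) :=
    (isUpperSet_connEvent ends a₁ a₃).compl.inter (isUpperSet_connEvent ends a₁ o).compl
  have h2 := prob_inter_le_prob_mul_prob_of_isLowerSet hp hlow (isUpperSet_connEvent ends a₃ o)
  rw [Set.inter_comm] at h2
  have h0 : 0 ≤ prob p ((connEvent ends a₁ a₃)ᶜ ∩ (connEvent ends a₁ o)ᶜ) := prob_nonneg hp _
  have h0' : 0 ≤ prob p (connEvent ends a₁ a₃) := prob_nonneg hp _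
  have h0'' : 0 ≤ prob p (connEvent ends a₃ o) := prob_nonneg hp _
  nlinarith [mul_le_mul_of_nonneg_right h1 h0, mul_le_mul_of_nonneg_right h2 h0']

set_option maxHeartbeats 1000000 in
/-- **Row 2′CD when `a₂` is a leaf at `o`**: `0 ≤ cdCleared p` for every admissible `p` and every
up-set `𝓔`, through the exact identity `cdCleared p = (1 − t)·q(t)` and the Bernstein positivity of
`q` (Harris, `zc_main` on `G − a₂`, `aux_odds`). -/
theorem cd_of_leaf_a₂ (p : E → R) (hp : IsProbVec p) (ends : E → Sym2 V) (a₁ a₂ a₃ o : V)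
    {f : E} (hf : ends f = s(a₂, o)) (hleaf : ∀ e, a₂ ∈ ends e → e = f) (h2o : a₂ ≠ o)
    (h12 : a₁ ≠ a₂) (h32 : a₃ ≠ a₂) {𝓔 : Set (Set V)} (h𝓔 : IsUpperSet 𝓔) :
    0 ≤ CDQC.cdCleared p ends a₁ a₂ a₃ o 𝓔 := by
  classical
  set p₀ := Function.update p f 0 with hp₀
  set p₁ := Function.update p f 1 with hp₁
  have hp0 : IsProbVec p₀ := hp.update f le_rfl zero_le_one
  set t := p f with ht
  have ht0 : 0 ≤ t := hp.nonneg f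
  have ht1 : t ≤ 1 := hp.le_one f
  set eG := connEvent ends a₁ a₃ with heG
  set LG := connEvent ends a₁ o with hLG
  set gG := connEvent ends a₃ o with hgG
  set UG := clusterInEvent ends a₁ 𝓔 with hUG
  set Q := (connEvent ends a₁ a₂)ᶜ with hQ
  set fE := connEvent ends a₂ o with hfE
  set N := (connEvent ends a₁ a₃)ᶜ ∩ (connEvent ends a₂ a₃)ᶜ with hN
  set oU := connEvent ends a₁ o ∪ connEvent ends a₂ o with hoU
  have c12 : ∀ ω : Config E, Conn ends (Function.update ω f true) a₁ a₂ ↔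
      Conn ends (Function.update ω f false) a₁ o := by
    intro ω
    constructor
    · intro h
      have h' := conn_symm h
      rw [conn_leaf_open_iff hf hleaf h2o ω h12] at h'
      exact conn_symm h'
    · intro h
      have h' := (conn_leaf_open_iff hf hleaf h2o ω h12).mpr (conn_symm h)
      exact conn_symm h'
  have c2o : ∀ ω : Config E, Conn ends (Function.update ω f true) a₂ o := by
    intro ω
    rw [conn_leaf_open_iff hf hleaf h2o ω h2o.symm]
    exact conn_refl _ _ _
  have c23 : ∀ ω : Config E, Conn ends (Function.update ω f true) a₂ a₃ ↔
      Conn ends (Function.update ω f false) o a₃ :=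
    fun ω => conn_leaf_open_iff hf hleaf h2o ω h32
  have c13 : ∀ ω : Config E, Conn ends (Function.update ω f true) a₁ a₃ ↔
      Conn ends (Function.update ω f false) a₁ a₃ := by
    intro ω
    rw [conn_pin_iff hf hleaf h2o true ω h12 h32, conn_pin_iff hf hleaf h2o false ω h12 h32]
  have c1o : ∀ ω : Config E, Conn ends (Function.update ω f true) a₁ o ↔
      Conn ends (Function.update ω f false) a₁ o := by
    intro ω
    rw [conn_pin_iff hf hleaf h2o true ω h12 h2o.symm, conn_pin_iff hf hleaf h2o false ω h12 h2o.symm]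
  have z12 : ∀ ω : Config E, ¬ Conn ends (Function.update ω f false) a₁ a₂ := fun ω h =>
    not_conn_leaf_closed hf hleaf h2o ω h12 (conn_symm h)
  have z2o : ∀ ω : Config E, ¬ Conn ends (Function.update ω f false) a₂ o := fun ω =>
    not_conn_leaf_closed hf hleaf h2o ω h2o.symm
  have z23 : ∀ ω : Config E, ¬ Conn ends (Function.update ω f false) a₂ a₃ := fun ω =>
    not_conn_leaf_closed hf hleaf h2o ω h32
  have cU : ∀ ω : Config E, ¬ Conn ends (Function.update ω f false) a₁ o →
      (Function.update ω f true ∈ UG ↔ Function.update ω f false ∈ UG) := by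
    intro ω hL
    simp only [hUG, mem_clusterInEvent]
    rw [cluster_open_eq_of_not_conn hf hleaf h2o h12 ω hL]
  have split : ∀ A : Set (Config E), prob p A = t * prob p₁ A + (1 - t) * prob p₀ A :=
    fun A => prob_eq_pin p A f
  have T1 : prob p₁ (Q ∩ N ∩ oU) = prob p₀ (LGᶜ ∩ eGᶜ ∩ gGᶜ) := by
    refine ZCPendant.prob_update_one_eq_update_zero p fun ω => ?_
    simp only [hQ, hN, hoU, heG, hLG, hgG, Set.mem_inter_iff, Set.mem_compl_iff, Set.mem_union,
      mem_connEvent, c12 ω, c13 ω, c23 ω, c2o ω]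
    constructor
    · rintro ⟨⟨h1, h2, h3⟩, _⟩
      exact ⟨⟨h1, h2⟩, fun h => h3 (conn_symm h)⟩
    · rintro ⟨⟨h1, h2⟩, h3⟩
      exact ⟨⟨h1, h2, fun h => h3 (conn_symm h)⟩, Or.inr trivial⟩
  have T2 : prob p₁ (Q ∩ N) = prob p₀ (LGᶜ ∩ eGᶜ ∩ gGᶜ) := by
    refine ZCPendant.prob_update_one_eq_update_zero p fun ω => ?_
    simp only [hQ, hN, heG, hLG, hgG, Set.mem_inter_iff, Set.mem_compl_iff, mem_connEvent, c12 ω,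
      c13 ω, c23 ω]
    constructor
    · rintro ⟨h1, h2, h3⟩
      exact ⟨⟨h1, h2⟩, fun h => h3 (conn_symm h)⟩
    · rintro ⟨⟨h1, h2⟩, h3⟩
      exact ⟨h1, h2, fun h => h3 (conn_symm h)⟩
  have T3 : prob p₁ Q = prob p₀ LGᶜ := by
    refine ZCPendant.prob_update_one_eq_update_zero p fun ω => ?_
    simp only [hQ, hLG, Set.mem_compl_iff, mem_connEvent, c12 ω]
  have T4 : prob p₁ (Q ∩ UG ∩ eG) = prob p₀ (LGᶜ ∩ UG ∩ eG) := by
    refine ZCPendant.prob_update_one_eq_update_zero p fun ω => ?_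
    simp only [hQ, Set.mem_inter_iff, Set.mem_compl_iff, mem_connEvent, c12 ω]
    constructor
    · rintro ⟨⟨h1, h2⟩, h3⟩
      exact ⟨⟨h1, (cU ω h1).mp h2⟩, (c13 ω).mp h3⟩
    · rintro ⟨⟨h1, h2⟩, h3⟩
      exact ⟨⟨h1, (cU ω h1).mpr h2⟩, (c13 ω).mpr h3⟩
  have T5 : prob p₁ (Q ∩ UG) = prob p₀ (LGᶜ ∩ UG) := by
    refine ZCPendant.prob_update_one_eq_update_zero p fun ω => ?_
    simp only [hQ, Set.mem_inter_iff, Set.mem_compl_iff, mem_connEvent, c12 ω]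
    constructor
    · rintro ⟨h1, h2⟩
      exact ⟨h1, (cU ω h1).mp h2⟩
    · rintro ⟨h1, h2⟩
      exact ⟨h1, (cU ω h1).mpr h2⟩
  have T6 : prob p₁ (Q ∩ eG) = prob p₀ (LGᶜ ∩ eG) := by
    refine ZCPendant.prob_update_one_eq_update_zero p fun ω => ?_
    simp only [hQ, heG, hLG, Set.mem_inter_iff, Set.mem_compl_iff, mem_connEvent, c12 ω, c13 ω]
  have T7 : prob p₁ (Q ∩ UG ∩ eG ∩ fE) = prob p₀ (LGᶜ ∩ UG ∩ eG) := by
    refine ZCPendant.prob_update_one_eq_update_zero p fun ω => ?_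
    simp only [hQ, hfE, Set.mem_inter_iff, Set.mem_compl_iff, mem_connEvent, c12 ω, c2o ω,
      and_true]
    constructor
    · rintro ⟨⟨h1, h2⟩, h3⟩
      exact ⟨⟨h1, (cU ω h1).mp h2⟩, (c13 ω).mp h3⟩
    · rintro ⟨⟨h1, h2⟩, h3⟩
      exact ⟨⟨h1, (cU ω h1).mpr h2⟩, (c13 ω).mpr h3⟩
  have T8 : prob p₁ (Q ∩ eG ∩ fE) = prob p₀ (LGᶜ ∩ eG) := by
    refine ZCPendant.prob_update_one_eq_update_zero p fun ω => ?_
    simp only [hQ, hfE, heG, hLG, Set.mem_inter_iff, Set.mem_compl_iff, mem_connEvent, c12 ω,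
      c13 ω, c2o ω, and_true]
  have C1 : prob p₀ (Q ∩ N ∩ oU) = prob p₀ (eGᶜ ∩ LG) := by
    refine prob_update_zero_congr p f fun ω => ?_
    simp only [hQ, hN, hoU, heG, hLG, Set.mem_inter_iff, Set.mem_compl_iff, Set.mem_union,
      mem_connEvent, z12 ω, z2o ω, z23 ω, not_false_eq_true, true_and, and_true, or_false]
  have C2 : prob p₀ (Q ∩ N) = prob p₀ eGᶜ := by
    refine prob_update_zero_congr p f fun ω => ?_
    simp only [hQ, hN, heG, Set.mem_inter_iff, Set.mem_compl_iff, mem_connEvent, z12 ω, z23 ω,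
      not_false_eq_true, true_and, and_true]
  have C3 : prob p₀ Q = 1 := by
    rw [show prob p₀ Q = prob p₀ Set.univ from prob_update_zero_congr p f fun ω => by
      simp only [hQ, Set.mem_compl_iff, mem_connEvent, z12 ω, not_false_eq_true, Set.mem_univ]]
    exact prob_univ p₀
  have C4 : prob p₀ (Q ∩ UG ∩ eG) = prob p₀ (UG ∩ eG) := by
    refine prob_update_zero_congr p f fun ω => ?_
    simp only [hQ, Set.mem_inter_iff, Set.mem_compl_iff, mem_connEvent, z12 ω, not_false_eq_true,
      true_and]
  have C5 : prob p₀ (Q ∩ UG) = prob p₀ UG := by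
    refine prob_update_zero_congr p f fun ω => ?_
    simp only [hQ, Set.mem_inter_iff, Set.mem_compl_iff, mem_connEvent, z12 ω, not_false_eq_true,
      true_and]
  have C6 : prob p₀ (Q ∩ eG) = prob p₀ eG := by
    refine prob_update_zero_congr p f fun ω => ?_
    simp only [hQ, Set.mem_inter_iff, Set.mem_compl_iff, mem_connEvent, z12 ω, not_false_eq_true,
      true_and]
  have C7 : prob p₀ (Q ∩ UG ∩ eG ∩ fE) = 0 := by
    rw [show prob p₀ (Q ∩ UG ∩ eG ∩ fE) = prob p₀ ∅ from prob_update_zero_congr p f fun ω => by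
      simp only [hfE, Set.mem_inter_iff, mem_connEvent, z2o ω, and_false, Set.mem_empty_iff_false]]
    exact prob_empty p₀
  have C8 : prob p₀ (Q ∩ eG ∩ fE) = 0 := by
    rw [show prob p₀ (Q ∩ eG ∩ fE) = prob p₀ ∅ from prob_update_zero_congr p f fun ω => by
      simp only [hfE, Set.mem_inter_iff, mem_connEvent, z2o ω, and_false, Set.mem_empty_iff_false]]
    exact prob_empty p₀
  set u := prob p₀ UG with hu
  set pe := prob p₀ eG with hpe
  set pL := prob p₀ LG with hpL
  set pUL := prob p₀ (UG ∩ LG) with hpUL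
  set pUe := prob p₀ (UG ∩ eG) with hpUe
  set pUeL := prob p₀ (UG ∩ (eG ∩ LG)) with hpUeL
  set pUeLc := prob p₀ (UG ∩ (eG ∩ LGᶜ)) with hpUeLc
  set peL := prob p₀ (eG ∩ LG) with hpeL
  set peLc := prob p₀ (eG ∩ LGᶜ) with hpeLc
  set chi := prob p₀ (eGᶜ ∩ LG) with hchi
  set etac := prob p₀ (eGᶜ ∩ LGᶜ ∩ gG) with hetac
  set etad := prob p₀ (eGᶜ ∩ LGᶜ ∩ gGᶜ) with hetad
  have r1 : prob p₀ (LGᶜ ∩ eGᶜ ∩ gGᶜ) = etad := by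
    rw [hetad]; congr 1; ext ω; simp only [Set.mem_inter_iff]; tauto
  have r2 : prob p₀ LGᶜ = 1 - pL := by
    have := prob_inter_add_prob_inter_compl p₀ Set.univ LG
    rw [Set.univ_inter, Set.univ_inter, prob_univ] at this
    linarith
  have r3 : prob p₀ (LGᶜ ∩ UG ∩ eG) = pUeLc := by
    rw [hpUeLc]; congr 1; ext ω; simp only [Set.mem_inter_iff]; tauto
  have r4 : prob p₀ (LGᶜ ∩ UG) = u - pUL := by
    have := prob_inter_add_prob_inter_compl p₀ UG LG
    rw [show LGᶜ ∩ UG = UG ∩ LGᶜ from Set.inter_comm _ _]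
    linarith
  have r5 : prob p₀ (LGᶜ ∩ eG) = peLc := by
    rw [hpeLc, Set.inter_comm]
  have r6 : prob p₀ eGᶜ = chi + etac + etad := by
    have h1 := prob_inter_add_prob_inter_compl p₀ eGᶜ LG
    have h2 := prob_inter_add_prob_inter_compl p₀ (eGᶜ ∩ LGᶜ) gG
    linarith
  have r7 : pUe = pUeL + pUeLc := by
    have := prob_inter_add_prob_inter_compl p₀ (UG ∩ eG) LG
    rw [Set.inter_assoc, Set.inter_assoc] at this
    linarith
  have r8 : pe = peL + peLc := by
    have := prob_inter_add_prob_inter_compl p₀ eG LG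
    linarith
  have hZC := ZCMain.zc_main p₀ hp0 ends a₁ a₃ o h𝓔
  simp only at hZC
  have hZC' : 0 ≤ etad * (pUeL - u * peL) - etac * (pUeLc - u * peLc) := by
    have e1 : (connEvent ends a₁ a₃)ᶜ ∩ (connEvent ends a₁ o)ᶜ ∩ (connEvent ends a₃ o)ᶜ =
        eGᶜ ∩ LGᶜ ∩ gGᶜ := rfl
    have e2 : (connEvent ends a₁ a₃)ᶜ ∩ (connEvent ends a₁ o)ᶜ ∩ connEvent ends a₃ o =
        eGᶜ ∩ LGᶜ ∩ gG := rfl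
    simpa [e1, e2, hetad, hetac, hpUeL, hpUe, hu, hpeL, hpUeLc, hpeLc] using hZC
  have hHarris_Ue : u * pe ≤ pUe :=
    prob_mul_prob_le_prob_inter hp0 (isUpperSet_clusterInEvent ends a₁ h𝓔)
      (isUpperSet_connEvent ends a₁ a₃)
  have hHarris_UL : u * pL ≤ pUL :=
    prob_mul_prob_le_prob_inter hp0 (isUpperSet_clusterInEvent ends a₁ h𝓔)
      (isUpperSet_connEvent ends a₁ o)
  have haux : etac * pe ≤ peL * (etac + etad) := by
    have h := aux_odds p₀ hp0 ends a₁ a₃ o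
    have s1 : connEvent ends a₃ o ∩ connEvent ends a₁ a₃ = eG ∩ LG := by
      ext ω
      simp only [Set.mem_inter_iff, heG, hLG, mem_connEvent]
      constructor
      · rintro ⟨h1, h2⟩; exact ⟨h2, conn_trans h2 h1⟩
      · rintro ⟨h1, h2⟩; exact ⟨conn_trans (conn_symm h1) h2, h1⟩
    have s2 : prob p₀ ((connEvent ends a₁ a₃)ᶜ ∩ (connEvent ends a₁ o)ᶜ) = etac + etad := by
      have := prob_inter_add_prob_inter_compl p₀ (eGᶜ ∩ LGᶜ) gG
      rw [hetac, hetad]; linarith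
    have s3 : connEvent ends a₃ o ∩ ((connEvent ends a₁ a₃)ᶜ ∩ (connEvent ends a₁ o)ᶜ) =
        eGᶜ ∩ LGᶜ ∩ gG := by
      ext ω; simp only [Set.mem_inter_iff]; tauto
    rw [s1, s2, s3] at h
    rw [hpeL, hetac, hpe]
    linarith
  have hchi0 : 0 ≤ chi := prob_nonneg hp0 _
  have hetad0 : 0 ≤ etad := prob_nonneg hp0 _
  have hetac0 : 0 ≤ etac := prob_nonneg hp0 _
  have hpe0 : 0 ≤ pe := prob_nonneg hp0 _
  have hpL1 : pL ≤ 1 := prob_le_one hp0 _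
  set B0 := chi * (pUe - u * pe) with hB0
  set B2 := etad * ((1 - pL) * pUeL - (u - pUL) * peL) - etac * ((1 - pL) * pUeLc - (u - pUL) * peLc)
    with hB2
  set B1 := (chi * ((1 - pL) * pUe - (u - pUL) * pe) +
    (etad * (pUeL - u * peL) - etac * (pUeLc - u * peLc))) / 2 with hB1
  have hB0' : 0 ≤ B0 := mul_nonneg hchi0 (by linarith)
  have hB2' : 0 ≤ B2 := by
    have e : B2 = (1 - pL) * (etad * (pUeL - u * peL) - etac * (pUeLc - u * peLc)) +
        (pUL - u * pL) * (etad * peL - etac * peLc) := by rw [hB2]; ring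
    rw [e]
    have h1 : 0 ≤ etad * peL - etac * peLc := by
      rw [r8] at haux
      have e1 : etac * (peL + peLc) = etac * peL + etac * peLc := by ring
      have e2 : peL * (etac + etad) = etac * peL + etad * peL := by ring
      linarith [e1, e2]
    exact add_nonneg (mul_nonneg (by linarith) hZC') (mul_nonneg (by linarith) h1)
  have hB1' : 0 ≤ B1 := by
    rw [hB1]
    have h1 : 0 ≤ (1 - pL) * pUe - (u - pUL) * pe := by
      have h0 : u - pUL ≤ u * (1 - pL) := by linarith [hHarris_UL]
      have ha : (u - pUL) * pe ≤ u * (1 - pL) * pe := mul_le_mul_of_nonneg_right h0 hpe0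
      have hb : u * pe * (1 - pL) ≤ pUe * (1 - pL) := mul_le_mul_of_nonneg_right hHarris_Ue (by linarith)
      have e1 : u * (1 - pL) * pe = u * pe * (1 - pL) := by ring
      have e2 : pUe * (1 - pL) = (1 - pL) * pUe := by ring
      linarith [ha, hb, e1, e2]
    have h2 : 0 ≤ chi * ((1 - pL) * pUe - (u - pUL) * pe) := mul_nonneg hchi0 h1
    linarith
  unfold CDQC.cdCleared
  simp only
  rw [split (Q ∩ N ∩ oU), split (Q ∩ N), split Q, split (Q ∩ UG ∩ eG), split (Q ∩ UG),
    split (Q ∩ eG), split (Q ∩ UG ∩ eG ∩ fE), split (Q ∩ eG ∩ fE),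
    T1, T2, T3, T4, T5, T6, T7, T8, C1, C2, C3, C4, C5, C6, C7, C8, r1, r2, r3, r4, r5, r6]
  -- `cdCleared = (1 − t)·[B0 (1−t)² + 2 B1 t (1−t) + B2 t²]`
  have hq : 0 ≤ (1 - t) * ((1 - t) ^ 2 * B0 + 2 * t * (1 - t) * B1 + t ^ 2 * B2) := by
    refine mul_nonneg (by linarith) (add_nonneg (add_nonneg ?_ ?_) ?_)
    · exact mul_nonneg (pow_nonneg (by linarith) 2) hB0'
    · exact mul_nonneg (mul_nonneg (mul_nonneg (by norm_num) ht0) (by linarith)) hB1'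
    · exact mul_nonneg (pow_nonneg ht0 2) hB2'
  rw [hB0, hB1, hB2] at hq
  rw [r7, r8] at hq ⊢
  linear_combination hq

end Main

end CDLeaf

end Summit.Ventures.PercRepro2
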